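import Mathlib
import Summits.KontsevichZagierPeriods.Zeta5Search.RecordCellCzAtlas
import Summits.KontsevichZagierPeriods.Zeta5Search.RecordCellCProof
import HarnessLib

/-!
# ζ(5) search — the ZERO CELL next to C is a THEOREM: `v_p(W) ≥ −4`, `v_p(V) ≥ −7`, hence `v_p(Cas₇(b(n))) ≥ −11`, for `8.2n < p ≤ 8.5n`

Cell `pub-zeta5` (HONEST FRAMING: systematic search; no irrationality claim unless certified), P1 prover seat generation 6.
On the record ray `b(n) = n·(41;17,…,11)`, for `n ≥ 2` and every prime `p` with `41n < 5p`, `2p ≤ 17n` (θ = p/n ∈ (41/5, 17/2];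
census g11 cells C′ ∪ C″, `STRUCTURE §15.4`; gen-2 g9's "zero" cell, REPORT-gen2-g9 §10, `DoubleDropBonus`): the tree's THEOREM LB gives
`v_p(Cas₇) ≥ −13`; here **`v_p(Cas₇(b(n))) ≥ −11`** (`recordCellCz`), two more, through the stronger digit-free facts
**`v_p(W(b′)) ≥ −4` and `v_p(V(b′)) ≥ −7` for `b′ = b(n)` and `b(n) + e₇`** (`zeroBlock`): the only minimal classes are the centre-free
four-point palindromes `ZS` of `RecordCellCzAtlas`, whose conjugate pairs `x`, `41n − (x+3p)` cancel in BOTH normalised leading digits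
(`digits_of_level` with the type `(1,−5,−5,1)` of cell C: `p⁵W_x ≡ −ĝ_xŵ`, `p⁵W_x̄ ≡ +ĝ_xŵ`, likewise `p⁸V`), while every other class has
`E_x ≥ −7`, so `‖W_x‖ ≤ p⁴`, `‖V_x‖ ≤ p⁷` termwise (Theorems A/A′, `ClassNuBound`).  Then
`p¹³Cas₇ = (p⁵W′)(p⁸V) − (p⁵W)(p⁸V′) ≡ 0 (mod p²)`.  (Census: truth `−11` on C′ = (25/3, 17/2), `−10` on C″ — the second digit is not
touched.)  Valuations of rationals; nothing about irrationality.  Exact cross-check: `code/p1/g6/cellCz_check.py` (7 primes, `n ≤ 13`).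
-/

noncomputable section

open Finset

namespace Summit.KontsevichZagierPeriods.Zeta5Search.CellC

open Summit.KontsevichZagierPeriods.Zeta5Search.DualSeries (InBox)
open Summit.KontsevichZagierPeriods.Zeta5Search.WedgeDictionary (pfData coeffW coeffV)
open Summit.KontsevichZagierPeriods.Zeta5Search.CasoratianValuation (InPolytope shift casoratian)
open Summit.KontsevichZagierPeriods.Zeta5Search.ClusterValuation
open Summit.KontsevichZagierPeriods.Zeta5Search.PadicSeries
open Summit.KontsevichZagierPeriods.Zeta5Search.BigPrime (shift_zero padicNorm_mul_le_one)
open Summit.KontsevichZagierPeriods.Zeta5Search.CellA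
open Summit.KontsevichZagierPeriods.Zeta5Search.LevelClass
open Summit.KontsevichZagierPeriods.Zeta5Search.CellD (digits_of_level padicNorm_classW_le padicNorm_classV_le_of small_of_two_mul)

variable {p : ℕ} [hp : Fact p.Prime]

/-! ### §1 Small `p`-adic bookkeeping -/

/-- `‖X‖ ≤ p^{k−1}` gives `‖p^k·X‖ ≤ p⁻¹`. -/
theorem small_scale {X : ℚ} {k : ℕ} (h : padicNorm p X ≤ (p : ℚ) ^ ((k : ℤ) - 1)) :
    padicNorm p ((p : ℚ) ^ k * X) ≤ (p : ℚ) ^ (-(1 : ℤ)) := by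
  have hp0 : (p : ℚ) ≠ 0 := Nat.cast_ne_zero.2 hp.out.ne_zero
  have hpos : (0 : ℚ) < (p : ℚ) ^ k := pow_pos (by exact_mod_cast hp.out.pos) k
  rw [padicNorm.mul, padicNorm_p_pow]
  calc ((p : ℚ) ^ k)⁻¹ * padicNorm p X ≤ ((p : ℚ) ^ k)⁻¹ * (p : ℚ) ^ ((k : ℤ) - 1) :=
        mul_le_mul_of_nonneg_left h (inv_nonneg.2 hpos.le)
    _ = (p : ℚ) ^ (-(1 : ℤ)) := by
        rw [← zpow_natCast, ← zpow_neg, ← zpow_add₀ hp0]; ring_nf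

/-- Products of two small numbers are `O(p²)`-small. -/
theorem small_mul_small {a c : ℚ} (ha : padicNorm p a ≤ (p : ℚ) ^ (-(1 : ℤ))) (hc : padicNorm p c ≤ (p : ℚ) ^ (-(1 : ℤ))) :
    padicNorm p (a * c) ≤ (p : ℚ) ^ (-(2 : ℤ)) := by
  have hp0 : (p : ℚ) ≠ 0 := Nat.cast_ne_zero.2 hp.out.ne_zero
  rw [padicNorm.mul]
  calc padicNorm p a * padicNorm p c ≤ (p : ℚ) ^ (-(1 : ℤ)) * (p : ℚ) ^ (-(1 : ℤ)) :=
        mul_le_mul ha hc (padicNorm.nonneg _) (zpow_p_nonneg _)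
    _ = (p : ℚ) ^ (-(2 : ℤ)) := by rw [← zpow_add₀ hp0]; norm_num

/-! ### §2 The zero block: `‖p⁵W(b′)‖ ≤ p⁻¹`, `‖p⁸V(b′)‖ ≤ p⁻¹` for any `b′` with the cell data -/

section ZeroBlock

variable {n : ℕ} (hp41 : 41 * n < 5 * p) (hp5 : 5 ≤ p)
  (b : ℕ → ℤ) (hb : InPolytope b) (hwin : (b 0 + 2 : ℤ) < (p : ℤ) ^ 2) (hN : (b 0).toNat = 41 * n)
  (hcen : ∀ x, x < p → 2 * x + 3 * p ≠ 41 * n → 2 * x + 4 * p ≠ 41 * n → ¬ CentreIn b p x)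
  (hZ : ∀ x ∈ ZS n p, netExp b x = 1 ∧ netExp b (x + p) = -5 ∧ netExp b (x + 2 * p) = -5 ∧ netExp b (x + 3 * p) = 1)
  (hrest : ∀ x, x < p → x ∉ ZS n p →
    padicNorm p (classW b p x) ≤ (p : ℚ) ^ (4 : ℤ) ∧ padicNorm p (classV b p x) ≤ (p : ℚ) ^ (7 : ℤ))

include hp41 hp5 hb hwin hN hcen hZ in
/-- **A `ZS` pair cancels in both digits**: `‖p⁵(W_x + W_x̄)‖ ≤ p⁻¹`, `‖p⁸(V_x + V_x̄)‖ ≤ p⁻¹`, `x̄ = 41n − (x+3p)`. -/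
theorem packZ {x : ℕ} (hx : x ∈ ZS n p) :
    padicNorm p ((p : ℚ) ^ 5 * (classW b p x + classW b p (41 * n - (x + 3 * p)))) ≤ (p : ℚ) ^ (-(1 : ℤ)) ∧
    padicNorm p ((p : ℚ) ^ 8 * (classV b p x + classV b p (41 * n - (x + 3 * p)))) ≤ (p : ℚ) ^ (-(1 : ℤ)) := by
  have hx' := conj_mem_zs hp41 hx
  obtain ⟨e0, e1, e2, e3⟩ := hZ x hx
  obtain ⟨f0, f1, f2, f3⟩ := hZ _ hx'
  rw [mem_zs] at hx hx'
  obtain ⟨hxp, h16, h25, h41, hself⟩ := hx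
  set g := gHat b p x with hgdef
  have hg0 : padicNorm p (gHat b p x - g) ≤ (p : ℚ) ^ (-(1 : ℤ)) := by
    rw [hgdef, sub_self, padicNorm.zero]; exact zpow_p_nonneg _
  obtain ⟨w1, v1, -, -, -, hconj⟩ := digits_of_level hp5 b hb hwin hN hxp (L := 3) (by omega) (by omega)
    (hcen x hxp hself (by omega)) typeExp_eC.2.2 (i₀ := 1) (by norm_num) (by decide) (he_of_four e0 e1 e2 e3) hg0
  have hg1 : padicNorm p (gHat b p (41 * n - (x + 3 * p)) - (-g)) ≤ (p : ℚ) ^ (-(1 : ℤ)) := by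
    rw [sub_neg_eq_add]; exact hconj
  obtain ⟨w2, v2, -, -, -, -⟩ := digits_of_level hp5 b hb hwin hN (x := 41 * n - (x + 3 * p)) (L := 3) (by omega)
    (by omega) (by omega) (hcen _ (by omega) hx'.2.2.2.2 (by omega)) typeExp_eC.2.2 (i₀ := 1) (by norm_num) (by decide)
    (he_of_four f0 f1 f2 f3) hg1
  refine ⟨?_, ?_⟩
  · have e : (p : ℚ) ^ 5 * (classW b p x + classW b p (41 * n - (x + 3 * p))) =
        ((p : ℚ) ^ 5 * classW b p x + g * typeW 3 eCS) +
          ((p : ℚ) ^ 5 * classW b p (41 * n - (x + 3 * p)) + (-g) * typeW 3 eCS) := by ring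
    rw [e]; exact small_add w1 w2
  · have e : (p : ℚ) ^ 8 * (classV b p x + classV b p (41 * n - (x + 3 * p))) =
        ((p : ℚ) ^ 8 * classV b p x - g * typeV 3 eCS) +
          ((p : ℚ) ^ 8 * classV b p (41 * n - (x + 3 * p)) - (-g) * typeV 3 eCS) := by ring
    rw [e]; exact small_add v1 v2

include hp41 in
omit hp in
/-- A sum over `ZS` equals the sum of the conjugates. -/
theorem sum_zs_conj (f : ℕ → ℚ) : ∑ x ∈ ZS n p, f (41 * n - (x + 3 * p)) = ∑ x ∈ ZS n p, f x :=
  sum_nbij' (fun x => 41 * n - (x + 3 * p)) (fun x => 41 * n - (x + 3 * p)) (fun x hx => conj_mem_zs hp41 hx)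
    (fun x hx => conj_mem_zs hp41 hx) (fun x hx => by have := mem_zs.1 hx; omega)
    (fun x hx => by have := mem_zs.1 hx; omega) (fun x hx => rfl)

include hp41 hp5 hb hwin hN hcen hZ hrest in
/-- **THE ZERO BLOCK**: `‖p⁵·W(b′)‖ ≤ p⁻¹` and `‖p⁸·V(b′)‖ ≤ p⁻¹`, i.e. `v_p(W(b′)) ≥ −4`, `v_p(V(b′)) ≥ −7`. -/
theorem zeroBlock : padicNorm p ((p : ℚ) ^ 5 * coeffW b) ≤ (p : ℚ) ^ (-(1 : ℤ)) ∧
    padicNorm p ((p : ℚ) ^ 8 * coeffV b) ≤ (p : ℚ) ^ (-(1 : ℤ)) := by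
  have PZ := fun x (hx : x ∈ ZS n p) => packZ hp41 hp5 b hb hwin hN hcen hZ hx
  have split : ∀ f : ℕ → ℚ, ∑ x ∈ range p, f x = ∑ x ∈ ZS n p, f x + ∑ x ∈ range p \ ZS n p, f x := fun f => by
    rw [← sum_union disjoint_sdiff, union_sdiff_of_subset (zs_subset n p)]
  refine ⟨?_, ?_⟩
  · rw [coeffW_eq_sum_classW b hp.out.pos, mul_sum, split]
    refine small_add (small_of_two_mul hp5 ?_) (padicNorm.sum_le' (fun x hx => ?_) (zpow_p_nonneg _))
    · have e2 : (2 : ℚ) * ∑ x ∈ ZS n p, (p : ℚ) ^ 5 * classW b p x =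
          ∑ x ∈ ZS n p, (p : ℚ) ^ 5 * (classW b p x + classW b p (41 * n - (x + 3 * p))) := by
        rw [two_mul, sum_congr rfl fun x _ => mul_add _ _ _, sum_add_distrib,
          sum_zs_conj hp41 (fun x => (p : ℚ) ^ 5 * classW b p x)]
      rw [e2]
      exact padicNorm.sum_le' (fun x hx => (PZ x hx).1) (zpow_p_nonneg _)
    · rw [mem_sdiff, mem_range] at hx
      exact small_scale (k := 5) (by have := (hrest x hx.1 hx.2).1; norm_num at this ⊢; exact this)
  · rw [coeffV_eq_sum_classV b hp.out.pos, mul_sum, split]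
    refine small_add (small_of_two_mul hp5 ?_) (padicNorm.sum_le' (fun x hx => ?_) (zpow_p_nonneg _))
    · have e2 : (2 : ℚ) * ∑ x ∈ ZS n p, (p : ℚ) ^ 8 * classV b p x =
          ∑ x ∈ ZS n p, (p : ℚ) ^ 8 * (classV b p x + classV b p (41 * n - (x + 3 * p))) := by
        rw [two_mul, sum_congr rfl fun x _ => mul_add _ _ _, sum_add_distrib,
          sum_zs_conj hp41 (fun x => (p : ℚ) ^ 8 * classV b p x)]
      rw [e2]
      exact padicNorm.sum_le' (fun x hx => (PZ x hx).2) (zpow_p_nonneg _)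
    · rw [mem_sdiff, mem_range] at hx
      exact small_scale (k := 8) (by have := (hrest x hx.1 hx.2).2; norm_num at this ⊢; exact this)

end ZeroBlock

/-! ### §3 The rest data for `b(n)` and `b(n) + e₇`, and the theorem -/

section Rest

variable {n : ℕ} (hn : 1 ≤ n) (hp41 : 41 * n < 5 * p) (hp17 : 2 * p ≤ 17 * n) (hp5 : 5 ≤ p)

include hp41 hp17 hp5 in
/-- Off `ZS`: `‖W_x(b)‖ ≤ p⁴`, `‖V_x(b)‖ ≤ p⁷` (class exponent `≥ −7`). -/
theorem restZ {x : ℕ} (hx : x < p) (hm : x ∉ ZS n p) :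
    padicNorm p (classW (bRec n) p x) ≤ (p : ℚ) ^ (4 : ℤ) ∧ padicNorm p (classV (bRec n) p x) ≤ (p : ℚ) ^ (7 : ℤ) := by
  have hb := inPolytope_bRec n
  have hwin : (bRec n 0 + 2 : ℤ) < (p : ℤ) ^ 2 := by rw [bRec_zero]; nlinarith
  have hodd : ¬ 2 ∣ p := fun h => by
    have := (Nat.prime_dvd_prime_iff_eq Nat.prime_two hp.out).1 h; omega
  have hE := classExpZ_ge_of_notMin hp41 hp17 hx hodd hm
  refine ⟨?_, ?_⟩
  · have := padicNorm_classW_le (m := -7) _ hb hp5 hwin (by norm_num) (fun _ => hE)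
    norm_num at this; exact this
  · have := padicNorm_classV_le_of (v := -7) _ hb hp5 hwin hx (fun _ => hE.trans (classExp_le_classNu _ _ _))
    norm_num at this; exact this

include hn hp41 hp17 hp5 in
/-- Off `ZS`: `‖W_x(b+e₇)‖ ≤ p⁴`, `‖V_x(b+e₇)‖ ≤ p⁷` (shift monotonicity of the class data). -/
theorem restZ_shift {x : ℕ} (hx : x < p) (hm : x ∉ ZS n p) :
    padicNorm p (classW (shift (bRec n) 7) p x) ≤ (p : ℚ) ^ (4 : ℤ) ∧
      padicNorm p (classV (shift (bRec n) 7) p x) ≤ (p : ℚ) ^ (7 : ℤ) := by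
  have hb := inPolytope_bRec n
  have hb' := inPolytope_shift_bRec n 7 hn (by norm_num) (by norm_num)
  have hwin : (bRec n 0 + 2 : ℤ) < (p : ℤ) ^ 2 := by rw [bRec_zero]; nlinarith
  have hwin' : (shift (bRec n) 7 0 + 2 : ℤ) < (p : ℤ) ^ 2 := by rw [shift_zero _ (by norm_num)]; exact hwin
  have hodd : ¬ 2 ∣ p := fun h => by
    have := (Nat.prime_dvd_prime_iff_eq Nat.prime_two hp.out).1 h; omega
  have hE := classExpZ_ge_of_notMin hp41 hp17 hx hodd hm
  have hE' : -7 ≤ classExp (shift (bRec n) 7) p x := hE.trans (classExp_shift_ge _ hb.1 (by norm_num) p x)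
  refine ⟨?_, ?_⟩
  · have := padicNorm_classW_le (m := -7) _ hb' hp5 hwin' (by norm_num) (fun _ => hE')
    norm_num at this; exact this
  · have := padicNorm_classV_le_of (v := -7) _ hb' hp5 hwin' hx (fun _ => hE'.trans (classExp_le_classNu _ _ _))
    norm_num at this; exact this

end Rest

/-- **THE ZERO CELL (41/5, 17/2] IS A THEOREM.**  For `n ≥ 2` and every prime `p` with `41n < 5p`, `2p ≤ 17n`:
`v_p(W(b′)) ≥ −4` and `v_p(V(b′)) ≥ −7` for `b′ = b(n), b(n)+e₇`, hence `v_p(Cas₇(b(n))) ≥ −11` (THEOREM LB: `−13`). -/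
theorem recordCellCz : ∀ n p : ℕ, 2 ≤ n → p.Prime → 41 * n < 5 * p → 2 * p ≤ 17 * n → casoratian (bRec n) 7 ≠ 0 →
    (-11 : ℤ) ≤ padicValRat p (casoratian (bRec n) 7) := by
  intro n p hn2 hprime hp41 hp17 hne
  haveI : Fact p.Prime := ⟨hprime⟩
  have hn : 1 ≤ n := by omega
  have hp5 : 5 ≤ p := by omega
  set b := bRec n with hbdef
  set b' := shift (bRec n) 7 with hb'def
  have hb : InPolytope b := inPolytope_bRec n
  have hb' : InPolytope b' := inPolytope_shift_bRec n 7 hn (by norm_num) (by norm_num)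
  have hwin : (b 0 + 2 : ℤ) < (p : ℤ) ^ 2 := by rw [hbdef, bRec_zero]; nlinarith
  have hwin' : (b' 0 + 2 : ℤ) < (p : ℤ) ^ 2 := by rw [hb'def, shift_zero _ (by norm_num)]; exact hwin
  have hN : (b 0).toNat = 41 * n := bRec_zero_toNat n
  have hN' : (b' 0).toNat = 41 * n := shift7_zero_toNat n
  have hcen : ∀ x, x < p → 2 * x + 3 * p ≠ 41 * n → 2 * x + 4 * p ≠ 41 * n → ¬ CentreIn b p x :=
    fun x hx h3 h4 => not_centreInZ hp41 hp17 hx h3 h4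
  have hcen' : ∀ x, x < p → 2 * x + 3 * p ≠ 41 * n → 2 * x + 4 * p ≠ 41 * n → ¬ CentreIn b' p x :=
    fun x hx h3 h4 h => not_centreInZ hp41 hp17 hx h3 h4 ((centreIn_shift (bRec n) (by norm_num : 1 ≤ 7) p x).1 h)
  have hZ := fun x (hx : x ∈ ZS n p) => (netExp_zs hp41 hp17 hx).1
  have hZ' := fun x (hx : x ∈ ZS n p) => (netExp_zs hp41 hp17 hx).2.1
  obtain ⟨sW, sV⟩ := zeroBlock hp41 hp5 b hb hwin hN hcen hZ (fun x hx hm => restZ hp41 hp17 hp5 hx hm)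
  obtain ⟨sW', sV'⟩ := zeroBlock hp41 hp5 b' hb' hwin' hN' hcen' hZ'
    (fun x hx hm => restZ_shift hn hp41 hp17 hp5 hx hm)
  have e : (p : ℚ) ^ 13 * casoratian b 7 =
      ((p : ℚ) ^ 5 * coeffW b') * ((p : ℚ) ^ 8 * coeffV b) - ((p : ℚ) ^ 5 * coeffW b) * ((p : ℚ) ^ 8 * coeffV b') := by
    rw [casoratian, ← hb'def]; ring
  have h13 : padicNorm p ((p : ℚ) ^ 13 * casoratian b 7) ≤ (p : ℚ) ^ (-(2 : ℤ)) := by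
    rw [e]
    exact (padicNorm.sub (p := p)).trans (max_le (small_mul_small sW' sV) (small_mul_small sW sV'))
  apply val_ge_of_padicNorm_le hne
  have hp0 : (p : ℚ) ≠ 0 := Nat.cast_ne_zero.2 hprime.ne_zero
  have hp13n : padicNorm p ((p : ℚ) ^ 13) = ((p : ℚ) ^ 13)⁻¹ := padicNorm_p_pow 13
  have hpos : (0 : ℚ) < (p : ℚ) ^ 13 := pow_pos (by exact_mod_cast hprime.pos) 13
  rw [padicNorm.mul, hp13n, inv_mul_le_iff₀ hpos] at h13
  refine h13.trans (le_of_eq ?_)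
  rw [neg_neg, ← zpow_natCast, ← zpow_add₀ hp0]
  norm_num

/-- The digit-free content, stated on its own: **`v_p(W(b(n))) ≥ −4` and `v_p(V(b(n))) ≥ −7`** on the cell. -/
theorem zeroCell_WV (n p : ℕ) (hn2 : 2 ≤ n) (hprime : p.Prime) (hp41 : 41 * n < 5 * p) (hp17 : 2 * p ≤ 17 * n) :
    (coeffW (bRec n) ≠ 0 → (-4 : ℤ) ≤ padicValRat p (coeffW (bRec n))) ∧
    (coeffV (bRec n) ≠ 0 → (-7 : ℤ) ≤ padicValRat p (coeffV (bRec n))) := by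
  haveI : Fact p.Prime := ⟨hprime⟩
  have hp5 : 5 ≤ p := by omega
  have hb : InPolytope (bRec n) := inPolytope_bRec n
  have hwin : (bRec n 0 + 2 : ℤ) < (p : ℤ) ^ 2 := by rw [bRec_zero]; nlinarith
  have hcen : ∀ x, x < p → 2 * x + 3 * p ≠ 41 * n → 2 * x + 4 * p ≠ 41 * n → ¬ CentreIn (bRec n) p x :=
    fun x hx h3 h4 => not_centreInZ hp41 hp17 hx h3 h4
  obtain ⟨sW, sV⟩ := zeroBlock hp41 hp5 (bRec n) hb hwin (bRec_zero_toNat n) hcen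
    (fun x hx => (netExp_zs hp41 hp17 hx).1) (fun x hx hm => restZ hp41 hp17 hp5 hx hm)
  have hp0 : (p : ℚ) ≠ 0 := Nat.cast_ne_zero.2 hprime.ne_zero
  have key : ∀ (k : ℕ) (X : ℚ), X ≠ 0 → padicNorm p ((p : ℚ) ^ k * X) ≤ (p : ℚ) ^ (-(1 : ℤ)) →
      (1 : ℤ) - k ≤ padicValRat p X := by
    intro k X hX h
    apply val_ge_of_padicNorm_le hX
    have hpk : padicNorm p ((p : ℚ) ^ k) = ((p : ℚ) ^ k)⁻¹ := padicNorm_p_pow k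
    have hpos : (0 : ℚ) < (p : ℚ) ^ k := pow_pos (by exact_mod_cast hprime.pos) k
    rw [padicNorm.mul, hpk, inv_mul_le_iff₀ hpos] at h
    refine h.trans (le_of_eq ?_)
    rw [← zpow_natCast, ← zpow_add₀ hp0]; congr 1; ring
  exact ⟨fun hW => by have := key 5 _ hW sW; norm_num at this; exact this,
    fun hV => by have := key 8 _ hV sV; norm_num at this; exact this⟩

end Summit.KontsevichZagierPeriods.Zeta5Search.CellC

end
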